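import Summits.ResolutionOfSingularities.ResolutionOfSingularities.Theorems.PurelyInseparableDim4ResConeCornerRigidTail
import HarnessLib
import HarnessLib.Audit.Tags

/-!
# Purely inseparable four-folds — ENTERING THE RIGID FRAME AT A LETTER CHANGE: after a chart-`a′` step with
# free translations every `x_{a′}`-free residual monomial is a CONE monomial, so the `x_a`-axis is clean; if the
# polar kernel is the coordinate plane at the next `a`-step, the whole tail is rigid — and impossible
# (K2(p) lane, SLICE C (C7d, part 1: the tree side), file-holder res-dim4-p-5 g3)

[OURS · counted 0 · cell `res-dim4-pi` · K2(p) lane (desk WORDS #78 (d), #80 (d), #96 (b)) · seat res-dim4-p-5 g3.]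
Nothing here proves K2(p), `NoIsolatedTrap p p` or resolution of singularities in dimension ≥ 4 /
characteristic `p`.

`…ResConeCornerRigidTail.no_rigidFrame_tail` wants, at ONE time `k₀`, the frame `e_a, e_{a′} ∈ resVertex (c k₀)`
AND both level-1 axes empty beyond `1`.  This file removes the axis hypotheses when `k₀` is a LETTER CHANGE:

* **`degree_eq_of_mem_support_step_of_apply_eq`** (THE INITIAL-DEGREE LAW of a band step with FREE translations —
  `b_i ≠ 0 ⇒ r_i = 0` — that keeps the shade): every monomial `x^E` of the child whose `x_j`-exponent is the new
  component's multiplicity (`E_j = r′_j`, i.e. residual `x_j`-exponent `0`) lies in the INITIAL degree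
  `|E| = |r′| + d` — it is the image of a monomial of the sheared cone `x^r · shear(g)` (layer `0` of
  `…ResConeLayerBirths`), all of which have `x_j`-exponent exactly `r_j`;
* `axisSlot_eq_zero_of_initialDegree` — hence the child's `x_i`-AXIS slots `x^{r′} · x_i^m · y^ν` (`m ≥ 2`,
  `ν` passive of degree `d − 1`, `i ≠ j`) are EMPTY (their residual degree is `d − 1 + m > d`);
* `frame_succ_of_chart` — one-sided propagation: frame + clean `x_a`-axis at an `a`-step ⇒ pure corner, frame
  and BOTH axes clean at the child (`…CornerRigidity`, `…CornerAxis`);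
* **`no_frame_of_initialDegree`** — entry at ONE `a`-step carrying the frame and the initial-degree law for `a′`;
* **`no_frame_at_letter_change`** — THE ENTRY THEOREM: no isolated above-floor witnessed `Step0 p` chain with
  `x^{r₀} ∣ F₀` has a tail (from `k₀`) of constant natural shade `d < p`, `e_G ≡ 2`, chart letters in `{a, a′}`,
  permanent light boundary letters `a, a′`, free translations, a LETTER CHANGE `j k₁ = a′, j (k₁+1) = a`
  (`k₁ ≥ k₀`) and the frame `e_a, e_{a′} ∈ resVertex (c (k₁+1))` at that single time.
What (C7d, part 2) must still supply is the frame at such a time — ONE linear straightening of the free letters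
transported along the chain (brick (ii) FILE E `exists_reframed_chain`, p-11 g3).
[cite: CossartJannsenSaito2020, Thm. 3.10(4), Thm. 3.14, Lemma 13.2, Lemma 13.4, Thm. 13.7]
bears_on: LADDER-RESOLUTION:D157-DOOR2 (res-dim4-pi · K2(p) = `RidgeBudget.NoAboveFloorTrap p p` · slice C).
Supports stmt-ResolutionOfSingularities-16155 (helper).
-/

set_option linter.dupNamespace false -- mandated namespace of this single-conjunct summit

noncomputable section

namespace Summit.ResolutionOfSingularities.ResolutionOfSingularities.Theorems.PIDim4

namespace ResCone

open MvPolynomial Finset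
open Literature.AlgebraicGeometry.Resolution
open Literature.AlgebraicGeometry.Resolution.CentreBlowup
open Literature.AlgebraicGeometry.Resolution.Hauser2010
open Literature.AlgebraicGeometry.Resolution.HauserPerlega2019
open PointBlowup (polarMap additiveSubspace direction)

variable {K : Type} [Field K]

/-! ## 1. The initial-degree law of a band step with free translations -/

section InitialDegree

variable [DecidableEq K]

/-- With FREE translations (`b_i ≠ 0 ⇒ r_i = 0`) the shear fixes the boundary monomial: `shear j b x^r = x^r`.
[folklore] -/
theorem shear_monomial_eq_of_free (j : Fin 4) {b : Fin 4 → K} (hbj : b j = 0) {r : Fin 4 →₀ ℕ}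
    (hfree : ∀ i, b i ≠ 0 → r i = 0) : shear j b (monomial r (1 : K)) = monomial r 1 := by
  have hfil : r.filter (fun i => b i = 0) = r := by
    ext i
    rw [Finsupp.filter_apply]
    split_ifs with hbi
    · rfl
    · exact (hfree i hbi).symm
  have h := shear_monomial_filter j hbj r
  rwa [hfil] at h

/-- With free translations the new boundary has degree `|r′| + r_j = (o − q) + |r|`. [folklore] -/
theorem degree_step_r_of_free (q : ℕ) (j : Fin 4) {b : Fin 4 → K} (hbj : b j = 0) (s : State K) {o : ℕ}
    (ho : ordZero s.F = o) (hr : ∀ d ∈ s.F.support, s.r ≤ d) (hfree : ∀ i, b i ≠ 0 → s.r i = 0) :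
    (CentreBlowup.step q Finset.univ j b s).r.degree + s.r j = (o - q) + s.r.degree := by
  have h := degree_step_r q j hbj s ho hr
  have hsum : ∑ i, s.r i * (if i = j ∨ b i ≠ 0 then 1 else 0) = s.r j := by
    rw [Finset.sum_eq_single j]
    · rw [if_pos (Or.inl rfl), mul_one]
    · intro i _ hij
      by_cases hbi : b i = 0
      · rw [if_neg (by push Not; exact ⟨hij, hbi⟩), mul_zero]
      · rw [hfree i hbi, zero_mul]
    · intro h; exact absurd (Finset.mem_univ j) h
  omega

/-- **THE INITIAL-DEGREE LAW**: at a shade-keeping band step with free translations, every monomial `x^E` of the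
child with `E_j = r′_j` (residual `x_j`-exponent `0`) has degree `|r′| + d` — it comes from the sheared cone.
[OURS] [cite: CossartJannsenSaito2020, Thm. 3.10(4), Thm. 9.3] -/
theorem degree_eq_of_mem_support_step_of_apply_eq {q : ℕ} (j : Fin 4) {b : Fin 4 → K} (hbj : b j = 0)
    {s : State K} {o : ℕ} (ho : ordZero s.F = o) (hr : ∀ d ∈ s.F.support, s.r ≤ d) (hqo : q < o)
    (ho2 : o < 2 * q) (heq : (CentreBlowup.step q Finset.univ j b s).shade = s.shade)
    (hfree : ∀ i, b i ≠ 0 → s.r i = 0) {E : Fin 4 →₀ ℕ}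
    (hE : E ∈ (CentreBlowup.step q Finset.univ j b s).F.support)
    (hEj : E j = (CentreBlowup.step q Finset.univ j b s).r j) :
    E.degree = (CentreBlowup.step q Finset.univ j b s).r.degree + (o - s.r.degree) := by
  classical
  have hq : (q : ℕ∞) ≤ ordAlong Finset.univ s.F := by
    rw [ordAlong_univ, ho]; exact_mod_cast hqo.le
  obtain ⟨e, he, heE, -⟩ := exists_of_mem_support_step q j hbj s hq hE
  -- the source lies in degree `o`
  have hedeg' := le_degree_of_mem_support (Straightening.le_ordAlong_univ_shear j b hq) he
  have hEj' : E j = e.degree - q := by rw [← heE, chartExponent_univ_apply_self]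
  have hrj : (CentreBlowup.step q Finset.univ j b s).r j = o - q := by
    rw [step_r_univ q j hbj s ho hr, Finsupp.coe_update, Function.update_self]
  have hedeg : e.degree = o := by
    have hoe : o ≤ e.degree := by
      by_contra hlt
      push Not at hlt
      -- monomials of `shear F` below degree `o` do not exist
      have hord : ((o : ℕ) : ℕ∞) ≤ ordAlong Finset.univ (shear j b s.F) :=
        Straightening.le_ordAlong_univ_shear j b (by rw [ordAlong_univ, ho])
      have := le_degree_of_mem_support hord he
      omega
    omega
  -- so it is a monomial of `shear (in F) = x^r · shear g`, whose `x_j`-exponent is `r_j`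
  have hmem : e ∈ (shear j b (initialForm s.F)).support := by
    rw [MvPolynomial.mem_support_iff]
    by_contra h0
    -- if `e ∉ supp shear(in F)` then `coeff e (shear F) = coeff e (shear (F − in F))`, of order `> o`
    have hsplit : shear j b s.F = shear j b (initialForm s.F) + shear j b (s.F - initialForm s.F) := by
      unfold shear; rw [← map_add, add_sub_cancel]
    have hc : coeff e (shear j b (s.F - initialForm s.F)) ≠ 0 := by
      have := MvPolynomial.mem_support_iff.mp he
      rwa [hsplit, coeff_add, h0, zero_add] at this
    have hord : ((o + 1 : ℕ) : ℕ∞) ≤ ordAlong Finset.univ (s.F - initialForm s.F) := by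
      refine le_ordAlong_of_forall fun d hd => ?_
      rw [degIn_univ]
      exact lt_degree_of_mem_support_sub_initialForm ho hd
    have h := le_degree_of_mem_support (Straightening.le_ordAlong_univ_shear j b hord)
      (MvPolynomial.mem_support_iff.mpr hc)
    omega
  rw [← monomial_mul_resForm hr] at hmem
  unfold shear at hmem
  rw [map_mul] at hmem
  change e ∈ (shear j b (monomial s.r (1 : K)) * shear j b (resForm s)).support at hmem
  rw [shear_monomial_eq_of_free j hbj hfree, MvPolynomial.mem_support_iff, coeff_monomial_mul'] at hmem
  split_ifs at hmem with hle
  · rw [one_mul] at hmem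
    have hμ : (e - s.r) j = 0 :=
      shear_resForm_free_of_shade_eq j hbj ho hr hqo ho2 heq _ (MvPolynomial.mem_support_iff.mpr hmem)
    have hej : e j = s.r j := by
      have := hle j
      rw [Finsupp.tsub_apply] at hμ
      omega
    have h2 := degree_chartExponent_univ q j (e := e) (by rw [hedeg]; exact hqo.le)
    rw [heE, hedeg, hej] at h2
    have h3 := degree_step_r_of_free q j hbj s ho hr hfree
    have hro := degree_r_le ho hr
    omega
  · exact absurd rfl hmem

/-- **Clean axis after a step**: under the initial-degree law, the child's `x_i`-axis slots `m ≥ 2` (`i ≠ j` an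
active letter, the other active letter being the chart `j`) are empty. [OURS] [cite: CossartJannsenSaito2020, Lemma 13.4] -/
theorem axisSlot_eq_zero_of_initialDegree {s : State K} {d : ℕ} {i j : Fin 4} (hij : i ≠ j)
    (hP : ∀ E ∈ s.F.support, E j = s.r j → E.degree = s.r.degree + d) {m : ℕ} (hm : 2 ≤ m) :
    ∀ ν : Fin 4 →₀ ℕ, ν i = 0 → ν j = 0 → ν.degree + 1 = d → coeff (s.r + ν + Finsupp.single i m) s.F = 0 := by
  intro ν _ hνj hν
  by_contra hne
  have h := hP _ (MvPolynomial.mem_support_iff.mpr hne) (by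
    rw [Finsupp.add_apply, Finsupp.add_apply, hνj, Finsupp.single_eq_of_ne hij.symm, add_zero, add_zero])
  rw [map_add, map_add, Finsupp.degree_single] at h
  omega

end InitialDegree

/-! ## 2. Entering the rigid frame -/

section Entry

variable (p : ℕ) [Fact p.Prime] [DecidableEq K]

/-- **One-sided propagation**: on the constant-`(d, e_G = 2)` tail, frame + clean `x_a`-axis (slots `≥ 2`) at an
`a`-step `k` with both letters boundary letters of the child ⇒ the step is a pure corner and the child has the
frame and BOTH axes clean. [OURS] [cite: CossartJannsenSaito2020, Thm. 3.10(4), Lemma 13.2, Lemma 13.4] -/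
theorem frame_succ_of_chart [CharP K p] {c : ℕ → State K} {j : ℕ → Fin 4} {b : ℕ → Fin 4 → K}
    (hc : ∀ k, IsIsolated p (c k).F ∧ Step0 p (c k) (c (k + 1))) (hw : FreeTail.IsWitnessedChain p c j b)
    (hr0 : ∀ e ∈ (c 0).F.support, (c 0).r ≤ e) (hfloor : ∀ k, ordZero (c k).F ≠ p) {k₀ d : ℕ} (hdp : d < p)
    (hshade : ∀ k, k₀ ≤ k → (c k).shade = (d : ℕ∞)) {a a' : Fin 4} (haa : a ≠ a') {k : ℕ} (hk : k₀ ≤ k)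
    (hjk : j k = a) (he : Module.finrank K (resVertex (c k)) = 2)
    (he' : Module.finrank K (resVertex (c (k + 1))) = 2)
    (hbdry : 1 ≤ (c (k + 1)).r a ∧ 1 ≤ (c (k + 1)).r a')
    (hframe : (Pi.single a 1 : Fin 4 → K) ∈ resVertex (c k) ∧ (Pi.single a' 1 : Fin 4 → K) ∈ resVertex (c k))
    (haxis : ∀ i, 2 ≤ i → ∀ ν : Fin 4 →₀ ℕ, ν a = 0 → ν a' = 0 → ν.degree + 1 = d →
      coeff ((c k).r + ν + Finsupp.single a i) (c k).F = 0) :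
    b k = 0 ∧
      ((Pi.single a 1 : Fin 4 → K) ∈ resVertex (c (k + 1)) ∧
        (Pi.single a' 1 : Fin 4 → K) ∈ resVertex (c (k + 1))) ∧
      (∀ i, 2 ≤ i → ∀ ν : Fin 4 →₀ ℕ, ν a = 0 → ν a' = 0 → ν.degree + 1 = d →
        coeff ((c (k + 1)).r + ν + Finsupp.single a i) (c (k + 1)).F = 0 ∧
          coeff ((c (k + 1)).r + ν + Finsupp.single a' i) (c (k + 1)).F = 0) := by
  have hb := corner_of_frame p hc hw hr0 hfloor hshade haa hk (Or.inl hjk) he hframe.1 hframe.2 hbdry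
  obtain ⟨o, ho, hpo, ho2⟩ := BandShade.exists_ordZero_eq p hc k
  have hp2 : 2 ≤ p := (Fact.out : p.Prime).two_le
  have hpo' : p < o := lt_of_le_of_ne hpo (fun h => hfloor k (by rw [ho, h]))
  have hrk := IsolatedBand.isolated_chain_forall_le hc hr0 k
  have hd : o - (c k).r.degree = d := ordZero_sub_degree_eq_of_shade ho (hshade k hk)
  have hstep : c (k + 1) = CentreBlowup.step p Finset.univ a 0 (c k) := by rw [(hw k).2.2.2.2, hb, hjk]
  have heqsh : (CentreBlowup.step p Finset.univ a 0 (c k)).shade = (c k).shade := by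
    rw [← hstep, hshade (k + 1) (by omega), hshade k hk]
  have he'' : Module.finrank K (resVertex (CentreBlowup.step p Finset.univ a 0 (c k))) = 2 := by
    rw [← hstep]; exact he'
  refine ⟨hb, ?_, ?_⟩
  · have h := single_mem_resVertex_step_of_slot_empty p haa ho hrk hpo' (by omega) heqsh (by omega) he
      hframe.1 hframe.2 he'' (fun ν hνa hνa' hν => haxis 2 le_rfl ν hνa hνa' (by omega))
    rw [hstep]; exact h
  · intro i hi ν hνa hνa' hν
    rw [hstep]
    exact ⟨axisSlot_step_zero_same p haa (c k) ho hrk hpo hd i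
        (fun μ hμa hμa' hμ => haxis (i + 1) (by omega) μ hμa hμa' hμ) ν hνa hνa' hν,
      axisSlot_step_zero_other p haa.symm (c k) ho hrk hpo hd hi ν hνa' hνa hν⟩

/-- **ENTRY FROM THE INITIAL-DEGREE LAW**: on the tail (constant natural shade `d < p`, `e_G ≡ 2`, chart letters in
`{a, a′}`, permanent light boundary letters), if at ONE `a`-step `k₁` the polar kernel is the coordinate plane and
every monomial of `F_{k₁}` with residual `x_{a′}`-exponent `0` lies in the initial degree, the chain cannot be
infinite. (The law holds after any chart-`a′` step with free translations — `no_frame_at_letter_change` — and is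
what a linear re-framing transports, (C7d) part 2.) [OURS]
[cite: CossartJannsenSaito2020, Thm. 3.10(4), Thm. 3.14, Lemma 13.2, Lemma 13.4, Thm. 13.7] -/
theorem no_frame_of_initialDegree [CharP K p] {c : ℕ → State K} {j : ℕ → Fin 4} {b : ℕ → Fin 4 → K}
    (hc : ∀ k, IsIsolated p (c k).F ∧ Step0 p (c k) (c (k + 1))) (hw : FreeTail.IsWitnessedChain p c j b)
    (hr0 : ∀ e ∈ (c 0).F.support, (c 0).r ≤ e) (hfloor : ∀ k, ordZero (c k).F ≠ p) {k₀ d : ℕ} (hdp : d < p)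
    (hshade : ∀ k, k₀ ≤ k → (c k).shade = (d : ℕ∞)) {a a' : Fin 4} (haa : a ≠ a')
    (hletters : ∀ k, k₀ ≤ k → (j k = a ∨ j k = a'))
    (he : ∀ k, k₀ ≤ k → Module.finrank K (resVertex (c k)) = 2)
    (hbdry : ∀ k, k₀ ≤ k → 1 ≤ (c k).r a ∧ 1 ≤ (c k).r a')
    (hlight : ∀ k, k₀ ≤ k → (c k).r a + (c k).r a' ≤ 2 * (c (k + 1)).r (j k))
    {k₁ : ℕ} (hk₁ : k₀ ≤ k₁) (hj : j k₁ = a)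
    (hframe : (Pi.single a 1 : Fin 4 → K) ∈ resVertex (c k₁) ∧ (Pi.single a' 1 : Fin 4 → K) ∈ resVertex (c k₁))
    (hP : ∀ E ∈ (c k₁).F.support, E a' = (c k₁).r a' → E.degree = (c k₁).r.degree + d) : False := by
  have haxis : ∀ i, 2 ≤ i → ∀ ν : Fin 4 →₀ ℕ, ν a = 0 → ν a' = 0 → ν.degree + 1 = d →
      coeff ((c k₁).r + ν + Finsupp.single a i) (c k₁).F = 0 :=
    fun i hi => axisSlot_eq_zero_of_initialDegree haa hP hi
  -- the `a`-step `k₁` is rigid: frame and both axes clean at `k₁ + 1`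
  obtain ⟨-, hframe2, haxes2⟩ := frame_succ_of_chart p hc hw hr0 hfloor hdp hshade haa hk₁ hj (he k₁ hk₁)
    (he (k₁ + 1) (by omega)) (hbdry (k₁ + 1) (by omega)) hframe haxis
  -- the rigid tail from `k₁ + 1`
  exact no_rigidFrame_tail p hc hw hr0 hfloor hdp (k₀ := k₁ + 1) (fun k hk => hshade k (by omega)) haa
    (fun k hk => hletters k (by omega)) (fun k hk => he k (by omega)) (fun k hk => hbdry k (by omega))
    (fun k hk => hlight k (by omega)) hframe2 haxes2

/-- **THE ENTRY THEOREM — the frame at ONE LETTER CHANGE suffices** (every prime): no isolated above-floor witnessed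
`Step0 p` chain with `x^{r₀} ∣ F₀` has, from some `k₀` on, constant natural shade `d < p`, `e_G ≡ 2`, chart letters
in `{a, a′}`, permanent boundary letters `a, a′` (`r ≥ 1`), light letters, FREE translations, together with a
letter change `j k₁ = a′`, `j (k₁ + 1) = a` (`k₀ ≤ k₁`) at which the polar kernel is the coordinate plane:
`e_a, e_{a′} ∈ resVertex (c (k₁ + 1))`. [OURS]
[cite: CossartJannsenSaito2020, Thm. 3.10(4), Thm. 3.14, Lemma 13.2, Lemma 13.4, Thm. 13.7] -/
theorem no_frame_at_letter_change [CharP K p] {c : ℕ → State K} {j : ℕ → Fin 4} {b : ℕ → Fin 4 → K}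
    (hc : ∀ k, IsIsolated p (c k).F ∧ Step0 p (c k) (c (k + 1))) (hw : FreeTail.IsWitnessedChain p c j b)
    (hr0 : ∀ e ∈ (c 0).F.support, (c 0).r ≤ e) (hfloor : ∀ k, ordZero (c k).F ≠ p) {k₀ d : ℕ} (hdp : d < p)
    (hshade : ∀ k, k₀ ≤ k → (c k).shade = (d : ℕ∞)) {a a' : Fin 4} (haa : a ≠ a')
    (hletters : ∀ k, k₀ ≤ k → (j k = a ∨ j k = a'))
    (he : ∀ k, k₀ ≤ k → Module.finrank K (resVertex (c k)) = 2)
    (hbdry : ∀ k, k₀ ≤ k → 1 ≤ (c k).r a ∧ 1 ≤ (c k).r a')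
    (hlight : ∀ k, k₀ ≤ k → (c k).r a + (c k).r a' ≤ 2 * (c (k + 1)).r (j k))
    (hfreeT : ∀ k, k₀ ≤ k → ∀ i, b k i ≠ 0 → (c k).r i = 0)
    {k₁ : ℕ} (hk₁ : k₀ ≤ k₁) (hj₁ : j k₁ = a') (hj₂ : j (k₁ + 1) = a)
    (hframe : (Pi.single a 1 : Fin 4 → K) ∈ resVertex (c (k₁ + 1)) ∧
      (Pi.single a' 1 : Fin 4 → K) ∈ resVertex (c (k₁ + 1))) : False := by
  -- the `a′`-step `k₁` has free translations, so its child obeys the initial-degree law for `a′`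
  obtain ⟨o, ho, hpo, ho2⟩ := chain_band p hc hfloor k₁
  have hrk := IsolatedBand.isolated_chain_forall_le hc hr0 k₁
  have hstep := (hw k₁).2.2.2.2
  have hbj : b k₁ (j k₁) = 0 := (hw k₁).2.1
  have heqsh : (CentreBlowup.step p Finset.univ (j k₁) (b k₁) (c k₁)).shade = (c k₁).shade :=
    chain_shade_step p hw hshade hk₁
  have hd : o - (c k₁).r.degree = d := ordZero_sub_degree_eq_of_shade ho (hshade k₁ hk₁)
  have hP : ∀ E ∈ (c (k₁ + 1)).F.support, E a' = (c (k₁ + 1)).r a' →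
      E.degree = (c (k₁ + 1)).r.degree + d := by
    intro E hE hEa
    rw [hstep] at hE hEa ⊢
    rw [hj₁] at hE hEa hbj heqsh ⊢
    have h := degree_eq_of_mem_support_step_of_apply_eq a' hbj ho hrk hpo ho2 heqsh (hfreeT k₁ hk₁) hE hEa
    rw [hd] at h
    exact h
  exact no_frame_of_initialDegree p hc hw hr0 hfloor hdp hshade haa hletters he hbdry hlight (k₁ := k₁ + 1)
    (by omega) hj₂ hframe hP

end Entry

end ResCone

end Summit.ResolutionOfSingularities.ResolutionOfSingularities.Theorems.PIDim4

end
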